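import Summits.NavierStokesRegularity.NavierStokesRegularity.Theorems.ThreadingFluxHorizonTowerDefs
import Summits.NavierStokesRegularity.NavierStokesRegularity.Theorems.ThreadingFluxHorizonTowerPoloidalFieldCalculus
import Literature.Analysis.FluidPDE.HelicityDensityTransport
import HarnessLib

/-!
# The horizon profile `U = curl curl(r^{1−l}H y)`: normal form, degree-zero homogeneity, `div U = 0`, `⟪curl U, y⟫ = 0`
# (conjuncts (1)–(3) of `HorizonTower.HorizonProfileStructure`; crux `PoloidalLiouville`, stmt-NavierStokesRegularity-1222, W1)

Support file for crux `PoloidalLiouville` (line «horizon-threading-tower» of planner ns-idea-15; Theorems-side statements in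
`ThreadingFluxHorizonTowerDefs.lean`, calculus in `ThreadingFluxHorizonTowerPoloidalFieldCalculus.lean`).  Experiment cell ARM A
`pub/ns-exp-scalarLiouville` g3, DIRECTOR-NS #262 (2) option (B).  Pure vector calculus; nothing about NS regularity.

For `l ≥ 1` and `H : ℝ³ → ℝ` smooth and homogeneous of degree `l` (`H(cy) = c^l H(y)` for all real `c`), put
`φ(z) = ‖z‖^{1−l} H(z)` (degree ONE, smooth off `0`) and `U = horizonProfile l H 0 = curl curl(φ y)`.  Then, off the origin:
* `horizonProfile_eq_normalForm` — `U(x) = 2∇φ(x) − (div ∇φ)(x) x` (conjunct (4) of the Prop up to the explicit evaluation of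
  `∇φ`, `div ∇φ`, which is NOT done here);
* `divergence_horizonProfile` — `div U = 0` (conjunct (2): `div curl = 0`);
* `inner_curl_horizonProfile` — `⟪curl U(x), x⟫ = 0` (conjunct (3): `curl ∇φ = 0`, `curl(ψ y) = ∇ψ × y ⊥ y`);
* `isZeroHomogeneousAbout_horizonProfile` — `U(cy) = U(y)` for `c > 0` (conjunct (1): `∇φ` has degree `0`, `div ∇φ`
  degree `−1`).
Harmonicity of `H` is not used for (1)–(3).  Conjuncts (4) (explicit radial/tangential split), (5) (the Laplace identity) and (6)
(`𝔏₁[U] ≡ 0`) remain.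
-/

-- the summit and its single problem share the name (D-0017 nested layout)
set_option linter.dupNamespace false

noncomputable section

open Set Function Filter Topology
open scoped Topology RealInnerProductSpace
open Literature.Analysis.FluidPDE

namespace Summit.NavierStokesRegularity.NavierStokesRegularity.Theorems.PoloidalLiouville.HorizonTower

open PoloidalField

/-! ### Generic: degree-zero homogeneous fields have degree-(−1) derivatives -/

/-- If `W(c z) = W(z)` for `z` near `y`, `c ≠ 0`, and `W` is differentiable at `y` and at `c y`, then
`DW(c y) = c⁻¹ DW(y)`. -/
theorem fderiv_smul_of_zeroHomogeneous {W : E3 → E3} {y : E3} {c : ℝ} (hc : c ≠ 0)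
    (hWy : DifferentiableAt ℝ W y) (hWc : DifferentiableAt ℝ W (c • y))
    (hhom : ∀ᶠ z in 𝓝 y, W (c • z) = W z) :
    fderiv ℝ W (c • y) = c⁻¹ • fderiv ℝ W y := by
  have hL : HasFDerivAt (fun z : E3 => c • z) (c • ContinuousLinearMap.id ℝ E3) y :=
    (hasFDerivAt_id y).const_smul c
  have h1 : HasFDerivAt (fun z => W (c • z)) ((fderiv ℝ W (c • y)).comp (c • ContinuousLinearMap.id ℝ E3)) y :=
    hWc.hasFDerivAt.comp y hL
  have h2 : HasFDerivAt (fun z => W (c • z)) (fderiv ℝ W y) y :=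
    hWy.hasFDerivAt.congr_of_eventuallyEq hhom
  have h3 : (fderiv ℝ W (c • y)).comp (c • ContinuousLinearMap.id ℝ E3) = fderiv ℝ W y := h1.unique h2
  have h4 : c • fderiv ℝ W (c • y) = fderiv ℝ W y := by
    rw [← h3]; ext v; simp
  rw [← h4, smul_smul, inv_mul_cancel₀ hc, one_smul]

/-- … hence `div W (c y) = c⁻¹ div W (y)`. -/
theorem divergence_smul_of_zeroHomogeneous {W : E3 → E3} {y : E3} {c : ℝ} (hc : c ≠ 0)
    (hWy : DifferentiableAt ℝ W y) (hWc : DifferentiableAt ℝ W (c • y))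
    (hhom : ∀ᶠ z in 𝓝 y, W (c • z) = W z) :
    VectorCalculus.divergence W (c • y) = c⁻¹ * VectorCalculus.divergence W y := by
  rw [VectorCalculus.divergence, VectorCalculus.divergence, fderiv_smul_of_zeroHomogeneous hc hWy hWc hhom,
    ContinuousLinearMap.toLinearMap_smul, map_smul, smul_eq_mul]

/-- The divergence of a field which is `C¹` near `x` is differentiable at `x` when the field is `C²` there
(`div W = tr ∘ DW`). -/
theorem differentiableAt_divergence {W : E3 → E3} {x : E3} (hW : ContDiffAt ℝ 2 W x) :
    DifferentiableAt ℝ (fun z => VectorCalculus.divergence W z) x := by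
  have hD : DifferentiableAt ℝ (fderiv ℝ W) x := (hW.fderiv_right (m := 1) (by norm_num)).differentiableAt (by simp)
  set T : (E3 →L[ℝ] E3) →ₗ[ℝ] ℝ := (LinearMap.trace ℝ E3).comp (ContinuousLinearMap.coeLM ℝ) with hT
  have hTc : DifferentiableAt ℝ (fun L : E3 →L[ℝ] E3 => T L) (fderiv ℝ W x) :=
    (LinearMap.toContinuousLinearMap T).differentiableAt
  have heq : (fun z => VectorCalculus.divergence W z) = fun z => T (fderiv ℝ W z) := by
    funext z; rfl
  rw [heq]
  exact hTc.comp x hD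

/-! ### The degree-one potential `φ = ‖z‖^{1−l} H` -/

section Profile

variable {l : ℕ} {H : E3 → ℝ}

/-- `‖z‖^{(1:ℤ)−l} = (‖z‖^{l−1})⁻¹` for `l ≥ 1` (also at `z = 0` with Lean's conventions). -/
theorem norm_zpow_one_sub (hl : 1 ≤ l) (z : E3) : ‖z‖ ^ ((1 : ℤ) - l) = (‖z‖ ^ (l - 1))⁻¹ := by
  have h : ((1 : ℤ) - l) = -((l - 1 : ℕ) : ℤ) := by omega
  rw [h, zpow_neg, zpow_natCast]

/-- The potential `φ = ‖z‖^{1−l} H` is smooth off the origin. -/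
theorem contDiffAt_potential (hl : 1 ≤ l) (hH : ContDiff ℝ (⊤ : ℕ∞) H) {z : E3} (hz : z ≠ 0) {n : WithTop ℕ∞}
    (hn : n ≤ (⊤ : ℕ∞)) :
    ContDiffAt ℝ n (fun z : E3 => ‖z‖ ^ ((1 : ℤ) - l) * H z) z := by
  have h1 : ContDiffAt ℝ n (fun z : E3 => (‖z‖ ^ (l - 1))⁻¹) z := by
    have hn' : ContDiffAt ℝ n (fun z : E3 => ‖z‖ ^ (l - 1)) z := (contDiffAt_norm ℝ hz).pow _
    exact hn'.inv (pow_ne_zero _ (norm_ne_zero_iff.2 hz))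
  have h2 : ContDiffAt ℝ n H z := (hH.of_le hn).contDiffAt
  exact (h1.mul h2).congr_of_eventuallyEq (Eventually.of_forall fun w => by simp only [norm_zpow_one_sub hl])

/-- The potential `φ = ‖z‖^{1−l} H` is homogeneous of degree one (`H` homogeneous of degree `l ≥ 1`). -/
theorem potential_smul (hl : 1 ≤ l) (hhom : ∀ (c : ℝ) (y : E3), H (c • y) = c ^ l * H y) :
    ∀ c : ℝ, 0 < c → ∀ y : E3, ‖c • y‖ ^ ((1 : ℤ) - l) * H (c • y) = c * (‖y‖ ^ ((1 : ℤ) - l) * H y) := by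
  intro c hc y
  rw [norm_zpow_one_sub hl, norm_zpow_one_sub hl, hhom, norm_smul, Real.norm_of_nonneg hc.le, mul_pow]
  obtain ⟨k, rfl⟩ : ∃ k, l = k + 1 := ⟨l - 1, by omega⟩
  simp only [Nat.add_sub_cancel]
  rw [mul_inv, pow_succ]
  have hck : c ^ k ≠ 0 := pow_ne_zero _ hc.ne'
  field_simp

variable (l H) in
/-- `horizonProfile l H 0 = curl curl (φ y)` with `φ z = ‖z‖^{1−l} H z` (the centre `0` substituted). -/
theorem horizonProfile_zero_eq :
    horizonProfile l H 0 = curl (curl (fun z : E3 => (‖z‖ ^ ((1 : ℤ) - l) * H z) • z)) := by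
  unfold horizonProfile
  simp only [sub_zero]

/-- **Normal form of the horizon profile**: off the origin, `U(x) = 2∇φ(x) − (div ∇φ)(x) x` with `φ = ‖z‖^{1−l}H`
(`H` smooth, homogeneous of degree `l ≥ 1`). -/
theorem horizonProfile_eq_normalForm (hl : 1 ≤ l) (hH : ContDiff ℝ (⊤ : ℕ∞) H)
    (hhom : ∀ (c : ℝ) (y : E3), H (c • y) = c ^ l * H y) {x : E3} (hx : x ≠ 0) :
    horizonProfile l H 0 x
      = (2 : ℝ) • gradient (fun z : E3 => ‖z‖ ^ ((1 : ℤ) - l) * H z) x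
        - (VectorCalculus.divergence (gradient (fun z : E3 => ‖z‖ ^ ((1 : ℤ) - l) * H z)) x) • x := by
  rw [horizonProfile_zero_eq]
  have hopen : ∀ᶠ y in 𝓝 x, y ≠ (0 : E3) := isOpen_compl_singleton.mem_nhds hx
  have hφd : ∀ᶠ y in 𝓝 x, DifferentiableAt ℝ (fun z : E3 => ‖z‖ ^ ((1 : ℤ) - l) * H z) y := by
    filter_upwards [hopen] with y hy
    exact (contDiffAt_potential hl hH hy (le_refl _)).differentiableAt (by simp)
  have hC2 : ContDiffAt ℝ 2 (fun z : E3 => ‖z‖ ^ ((1 : ℤ) - l) * H z) x :=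
    contDiffAt_potential hl hH hx (by norm_cast)
  have hg : DifferentiableAt ℝ (gradient (fun z : E3 => ‖z‖ ^ ((1 : ℤ) - l) * H z)) x := by
    have hD : DifferentiableAt ℝ (fderiv ℝ (fun z : E3 => ‖z‖ ^ ((1 : ℤ) - l) * H z)) x :=
      (hC2.fderiv_right (m := 1) (by norm_num)).differentiableAt (by simp)
    exact ((InnerProductSpace.toDual ℝ E3).symm.differentiableAt).comp x hD
  exact curl_curl_smul_self_of_oneHomogeneous hφd hg (potential_smul hl hhom)

/-- **Conjunct (2): `div U = 0` off the origin** (`U = curl V`, `V = curl(φ y)` of class `C²` there). -/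
theorem divergence_horizonProfile (hl : 1 ≤ l) (hH : ContDiff ℝ (⊤ : ℕ∞) H) {x : E3} (hx : x ≠ 0) :
    VectorCalculus.divergence (horizonProfile l H 0) x = 0 := by
  rw [horizonProfile_zero_eq]
  apply HelicityDensityTransport.divergence_curl_eq_zero_of_contDiffAt
  -- `curl (φ y)` is `C²` at `x`: `curl = curlCLM ∘ D`, and `φ y` is `C³` near `x`
  have h3 : ContDiffAt ℝ 3 (fun z : E3 => (‖z‖ ^ ((1 : ℤ) - l) * H z) • z) x :=
    (contDiffAt_potential hl hH hx (by norm_cast)).smul contDiffAt_id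
  rw [curl_eq_curlCLM_comp]
  exact curlCLM.contDiff.contDiffAt.comp x (h3.fderiv_right (m := 2) (by norm_num))

/-- **Conjunct (3): `⟪curl U(x), x⟫ = 0` off the origin** (the horizon profile is unthreaded). -/
theorem inner_curl_horizonProfile (hl : 1 ≤ l) (hH : ContDiff ℝ (⊤ : ℕ∞) H)
    (hhom : ∀ (c : ℝ) (y : E3), H (c • y) = c ^ l * H y) {x : E3} (hx : x ≠ 0) :
    inner ℝ (curl (horizonProfile l H 0) x) x = 0 := by
  -- near `x`, `U` is the normal form
  have hopen : ∀ᶠ y in 𝓝 x, y ≠ (0 : E3) := isOpen_compl_singleton.mem_nhds hx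
  have hev : horizonProfile l H 0 =ᶠ[𝓝 x] fun y =>
      (2 : ℝ) • gradient (fun z : E3 => ‖z‖ ^ ((1 : ℤ) - l) * H z) y
        - (VectorCalculus.divergence (gradient (fun z : E3 => ‖z‖ ^ ((1 : ℤ) - l) * H z)) y) • y := by
    filter_upwards [hopen] with y hy
    exact horizonProfile_eq_normalForm hl hH hhom hy
  rw [curl_eq_curlCLM, hev.fderiv_eq, ← curl_eq_curlCLM]
  have hC2 : ContDiffAt ℝ 2 (fun z : E3 => ‖z‖ ^ ((1 : ℤ) - l) * H z) x :=
    contDiffAt_potential hl hH hx (by norm_cast)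
  have hC3 : ContDiffAt ℝ 3 (fun z : E3 => ‖z‖ ^ ((1 : ℤ) - l) * H z) x :=
    contDiffAt_potential hl hH hx (by norm_cast)
  -- `ψ = div ∇φ` is differentiable at `x` (`∇φ` is `C²` there)
  have hgc : ContDiffAt ℝ 2 (gradient (fun z : E3 => ‖z‖ ^ ((1 : ℤ) - l) * H z)) x := by
    have hD : ContDiffAt ℝ 2 (fderiv ℝ (fun z : E3 => ‖z‖ ^ ((1 : ℤ) - l) * H z)) x :=
      hC3.fderiv_right (m := 2) (by norm_num)
    exact (InnerProductSpace.toDual ℝ E3).symm.contDiff.contDiffAt.comp x hD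
  exact inner_curl_sub_smul_self hC2 (differentiableAt_divergence hgc)

/-- **Conjunct (1): degree-zero homogeneity** of the horizon profile, `U(0 + c y) = U(0 + y)` for `c > 0`. -/
theorem isZeroHomogeneousAbout_horizonProfile (hl : 1 ≤ l) (hH : ContDiff ℝ (⊤ : ℕ∞) H)
    (hhom : ∀ (c : ℝ) (y : E3), H (c • y) = c ^ l * H y) :
    IsZeroHomogeneousAbout 0 (horizonProfile l H 0) := by
  intro c hc y
  rw [zero_add, zero_add]
  by_cases hy : y = 0
  · rw [hy, smul_zero]
  have hcy : c • y ≠ 0 := smul_ne_zero hc.ne' hy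
  rw [horizonProfile_eq_normalForm hl hH hhom hcy, horizonProfile_eq_normalForm hl hH hhom hy]
  set φ : E3 → ℝ := fun z : E3 => ‖z‖ ^ ((1 : ℤ) - l) * H z with hφ
  have hφhom := potential_smul hl hhom
  have hφd : ∀ z : E3, z ≠ 0 → DifferentiableAt ℝ φ z := fun z hz =>
    (contDiffAt_potential hl hH hz (le_refl _)).differentiableAt (by simp)
  -- `∇φ` is degree-zero homogeneous off the origin
  have hW : ∀ z : E3, z ≠ 0 → gradient φ (c • z) = gradient φ z := fun z hz =>
    gradient_smul_of_oneHomogeneous hc (hφd z hz) (hφd _ (smul_ne_zero hc.ne' hz)) hφhom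
  -- `∇φ` is differentiable off the origin
  have hgd : ∀ z : E3, z ≠ 0 → DifferentiableAt ℝ (gradient φ) z := by
    intro z hz
    have hC2 : ContDiffAt ℝ 2 φ z := contDiffAt_potential hl hH hz (by norm_cast)
    have hD : DifferentiableAt ℝ (fderiv ℝ φ) z := (hC2.fderiv_right (m := 1) (by norm_num)).differentiableAt (by simp)
    exact ((InnerProductSpace.toDual ℝ E3).symm.differentiableAt).comp z hD
  have hev : ∀ᶠ z in 𝓝 y, gradient φ (c • z) = gradient φ z := by
    filter_upwards [isOpen_compl_singleton.mem_nhds hy] with z hz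
    exact hW z hz
  have hdiv := divergence_smul_of_zeroHomogeneous hc.ne' (hgd y hy) (hgd _ hcy) hev
  rw [hW y hy, hdiv, smul_smul, mul_comm, ← mul_assoc, mul_inv_cancel₀ hc.ne', one_mul]

end Profile

end Summit.NavierStokesRegularity.NavierStokesRegularity.Theorems.PoloidalLiouville.HorizonTower

end
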